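import Literature.AlgebraicGeometry.HodgeTheory.BettiHodgeConjectureProductsOffMiddleAlgebraicFactor
import Literature.AlgebraicGeometry.HodgeTheory.CorrespondenceTranspose
import Literature.AlgebraicGeometry.HodgeTheory.MotivatedClassesAlgebraic
import HarnessLib

/-!
# `HC(X × X)` for an off-middle-algebraic `X` whose Hodge endomorphisms of `Hⁿ(X)` are spanned by algebraic correspondences: the middle Künneth component of ANY algebraic class on `X × X`
# is algebraic and acts as the class does; `dim End_HS(HⁿX) ≤ r` with `r` algebraic correspondences acting independently on `Hⁿ(X;ℂ)` ⇒ `HC(X × X)`; the case `{Δ, ᵗΓ_σ}` of an endomorphism `σ`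
# (Voisin I §11.3.3 Thm. 11.38–11.40, Lemma 11.41, pp. 286–287; Voisin 2025 §3.2.1; Fulton §16.1; Kahn Ex. 3.47)

Family `hodge`, lane `lit-hodgefound` (Track 2 foundations library; Layers A1/A4), layer `Literature/AlgebraicGeometry/HodgeTheory`.  THEOREMS ONLY (no definition, no named fact, no instance;
D-0026 net debt `0`).  The seat's g29-#6 (`BettiHodgeConjectureSquareOffMiddleAlgebraic`) proved, for `X` OFF-MIDDLE ALGEBRAIC (`Hᵏ(X;ℚ) = 0` for odd `k ≠ n = dim X`, `Hdgᵖ(H^{2p}X) = H^{2p}(X;ℚ)` for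
`2p ≠ n`) with `HC(X)`, that the middle Künneth component `t_{n,n}` of the DIAGONAL is a Hodge class of `Hⁿ(X) ⊗ Hⁿ(X)` with algebraic cross product acting as `Id` on `Hⁿ(X;ℂ)`, whence `HC(X × X)` when
`dim End_HS(HⁿX) ≤ 1`.  The same argument applies to EVERY rational algebraic class `γ` on `X × X` (a codimension-`n` cycle: the graph of an endomorphism, a correspondence): its middle Künneth
component `t_γ` is a Hodge class with algebraic cross product acting on `Hⁿ(X;ℂ)` as `γ_*` does.  Consequently, if `r` such classes act ℂ-linearly independently on `Hⁿ(X;ℂ)` and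
`dim_ℚ End_HS(HⁿX) ≤ r`, the `t_γ` span `Hdgⁿ(HⁿX ⊗ HⁿX)` (Lemma 11.41) and `HC(X × X)` follows — «the Hodge conjecture for `X × X` in middle degree holds as soon as `End_HS(HⁿX)` is generated by
algebraic correspondences».

WHAT IS PROVED.
* §1 **`BettiUniverse.exists_kunneth_middle_algebraic_corrAction_eq`**: `X` off-middle algebraic with `HC(X)`, `γ ∈ H^{2n}(X × X;ℚ)` with `γ ⊗ 1` algebraic ⇒ there is a Hodge class `t ∈ Hdgⁿ(HⁿX ⊗ HⁿX)` with
  `crossMap t ⊗ 1` algebraic and `(crossMap t ⊗ 1)_* = (γ ⊗ 1)_*` on `Hⁿ(X;ℂ)` (`γ ⊗ 1` is a Hodge class, Prop. 11.20; its other Künneth components are zero or have a pure factor, g29-#6 §1; the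
  pieces `Hⁱ ⊗ Hʲ`, `j ≠ n`, act by zero on `Hⁿ`).
* §2 **`BettiUniverse.hodgeConjectureFor_tensor_self_of_offMiddle_algebraic_of_linearIndependent_corrAction`**: `X` off-middle algebraic with `HC(X)`, a finite family `γᵢ` (`i ∈ ι`) of
  rational classes of `H^{2n}(X × X)` with algebraic complexifications whose actions `(γᵢ ⊗ 1)_*` on `Hⁿ(X;ℂ)` are ℂ-linearly independent, and `dim_ℚ End_HS(HⁿX) ≤ |ι|` ⇒ `HC(X × X)`
  (for `ι = {Δ}` this is g29-#6 §3).
* §3 **`BettiUniverse.hodgeConjectureFor_tensor_self_of_offMiddle_algebraic_of_endomorphism`**: `X` off-middle algebraic with `HC(X)` and an endomorphism `σ : X ⟶ X` such that `Id` and `σ^*|Hⁿ(X;ℂ)`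
  are linearly independent and `dim_ℚ End_HS(HⁿX) ≤ 2` ⇒ `HC(X × X)` (the classes `[Δ]` and `[ᵗΓ_σ] = (𝟙, σ)_* 1`, rational and algebraic, acting as `Id` and `σ^*` — the tree's
  `corrAction_diagonalClass_eq_id`, `corrAction_transposeGraph_one`); §4 the reading on smooth hypersurfaces of odd dimension
  (**`IsSmoothHypersurface.hodgeConjectureFor_tensor_self_of_odd_of_endomorphism`**, e.g. a hypersurface with an automorphism acting non-trivially on `Hⁿ` and `End_HS(HⁿX) = ℚ[σ^*]` of
  dimension `2`).

THE PRINTS.  C. Voisin (2002) [VoisinHodgeI2002] §11.1.2 Prop. 11.20, §11.3.3 Thm. 11.38, Thm. 11.40, p. 287 (Künneth components of algebraic / Hodge classes), Lemma 11.41, pp. 286–287 (actions of classes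
of `Hᵏ ⊗ Hˡ`).  C. Voisin (2003) [VoisinHodgeII2003] §1.2.3 Cor. 1.24–1.25, §9.2.4 Prop. 9.20, §10.2.2 proof of Thm. 10.17 (10.7).  C. Voisin (2025) [Voisin2025] §3.2.1 (12)–(14), Prop. 3.8, Cor. 3.9.
W. Fulton (1998) [Fulton1998] §16.1 Prop. 16.1.1–16.1.2, Def. 16.1.2 (correspondences, graphs).  B. Kahn (2020) [Kahn2020] §3.5.3 Example 3.47 (`[ᵗΓ_f]_* = f^*`).  P. Deligne (2000/2006) [Deligne2000] §1.

THE OBJECTS (all the tree's).  `X : SchemeOver ℂ`, `hX : IsSmoothProjective n X`, `hXX : IsSmoothProjective d (X ⊗ X)`, `σ : X ⟶ X`; `hHD : exists_isReal_hodgeModel`; `Hᵏ(X) = BettiUniverse.hodge hHD hX k`,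
`hodgeClasses`, `HodgeStructure.Hom`, `tensor`; `BettiUniverse.kunnethSummand`, `BettiUniverse.crossMap`; `corrAction complexOrientationFamily` (`γ ↦ γ_*`), `complexGysin`, `diagonalClass`,
`complexBetti.map σ n` (`σ^*`); `bettiCohomology`, `complexBetti`, `ofRatClass`, `IsRationalClass`, `algebraicClasses`, `HodgeConjectureFor`.

DEVIATIONS / SCOPE.  Linear independence of the actions and the bound on `dim End_HS(HⁿX)` are hypotheses; which correspondences to use is the geometry of the particular `X`.  No definitions.

## References
* [VoisinHodgeI2002] C. Voisin, *Hodge Theory and Complex Algebraic Geometry I* (2002) — §11.1.2 Prop. 11.20; §11.3.3 Thm. 11.38, Thm. 11.40, Lemma 11.41, pp. 286–287.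
* [VoisinHodgeII2003] C. Voisin, *Hodge Theory and Complex Algebraic Geometry II* (2003) — §1.2.3 Cor. 1.24–1.25; §9.2.4 Prop. 9.20; §10.2.2 proof of Thm. 10.17 (10.7).
* [Voisin2025] C. Voisin, *Cycle classes on algebraic varieties* (2025) — §3.2.1 (12)–(14), Prop. 3.8, Cor. 3.9.
* [Fulton1998] W. Fulton, *Intersection Theory* (2nd ed., 1998) — §16.1 Prop. 16.1.1, Prop. 16.1.2, Def. 16.1.2.
* [Kahn2020] B. Kahn, *Zeta and L-functions of varieties and motives* (2020) — §3.5.3 Example 3.47.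
* [Deligne2000] P. Deligne, *The Hodge conjecture* (Clay problem description) — §1.
* [HatcherAT2002] A. Hatcher, *Algebraic Topology* (2002) — §3.1 p. 198.

## Provenance
Lane `lit-hodgefound` (Hodge path, Track 2), prover seat `lit-hodgefound-p29` (generation 29), self-proposed row g29-#11 (g29-#6 with the diagonal replaced by any algebraic correspondence).
-/

noncomputable section

open scoped TensorProduct
open CategoryTheory MonoidalCategory CartesianMonoidalCategory Module Finset
open Literature.AlgebraicTopology.SingularHomology
open Literature.Geometry.Kaehler

namespace Literature.AlgebraicGeometry.HodgeTheory

open Literature.AlgebraicGeometry.Motives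
open Literature.AlgebraicGeometry.Motives.HodgeStructure

variable {n d : ℕ} {X : SchemeOver ℂ}

/-! ### §0 Plumbing -/

/-- `(q • a) ⊗ 1 = q • (a ⊗ 1)` for the lattice map `Hᵏ(Y;ℚ) → Hᵏ(Y;ℂ)` (private copy of the tree's file-local lemma). [cite: HatcherAT2002, §3.1 p. 198] -/
private theorem ofRatClass_rat_smul' {T : Type} [TopologicalSpace T] {k : ℕ} (q : ℚ) (a : singularCohomology ℚ ℚ T k) :
    ofRatClass T k (q • a) = (q : ℂ) • ofRatClass T k a := by
  rw [ofRatClass, coeffClass_smul, smul_coeffClass]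
  refine coeffClass_congr (fun x ↦ ?_) a
  simp

/-! ### §1 The middle Künneth component of an algebraic correspondence -/

section Middle

variable [HodgeTensorFacts.{0, 0}]

/-- **The middle Künneth component of an algebraic class on `X × X`.**  Let `X` be smooth projective of dimension `n` with `HC(X)`, `Hᵏ(X;ℚ) = 0` for odd `k ≠ n` and `Hdgᵖ(H^{2p}X) = H^{2p}(X;ℚ)` for `2p ≠ n`,
and let `γ ∈ H^{2n}(X × X;ℚ)` have algebraic complexification (a codimension-`n` correspondence).  Then there is a Hodge class `t ∈ Hdgⁿ(HⁿX ⊗ HⁿX)` with `crossMap t ⊗ 1` ALGEBRAIC and acting on `Hⁿ(X;ℂ)`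
as `γ ⊗ 1` does: `γ ⊗ 1` is a Hodge class (Prop. 11.20), its other Künneth components are zero (a factor of odd degree `≠ n`) or have a pure factor (g29-#6 §1) hence algebraic cross products, and a piece
`Hⁱ ⊗ Hʲ` with `j ≠ n` acts by zero on `Hⁿ`. [cite: VoisinHodgeI2002, §11.1.2 Prop. 11.20, §11.3.3 Thm. 11.38–11.40 and pp. 286–287] [cite: Voisin2025, §3.2.1 (12)–(14)] -/
theorem BettiUniverse.exists_kunneth_middle_algebraic_corrAction_eq (hHD : exists_isReal_hodgeModel) (hX : IsSmoothProjective n X) (hHC : HodgeConjectureFor n X)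
    (hodd : ∀ k, Odd k → k ≠ n → Module.finrank ℚ (bettiCohomology X k) = 0) (heven : ∀ p, 2 * p ≠ n → (BettiUniverse.hodge hHD hX (2 * p)).hodgeClasses p = ⊤)
    {γ : bettiCohomology (X ⊗ X) (2 * n)} (hγ : ofRatClass (ComplexPoints (X ⊗ X)) (2 * n) γ ∈ algebraicClasses (X ⊗ X) n) :
    ∃ t ∈ (BettiUniverse.kunnethSummand hHD hX hX (2 * n) ⟨(n, n), HasAntidiagonal.mem_antidiagonal.2 (two_mul n).symm⟩).hodgeClasses n,
      ofRatClass (ComplexPoints (X ⊗ X)) (2 * n) (BettiUniverse.crossMap X X (two_mul n).symm t) ∈ algebraicClasses (X ⊗ X) n ∧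
      corrAction complexOrientationFamily hX hX (rfl : n + 2 * n = n + 2 * n) (ofRatClass (ComplexPoints (X ⊗ X)) (2 * n) (BettiUniverse.crossMap X X (two_mul n).symm t)) =
        corrAction complexOrientationFamily hX hX (rfl : n + 2 * n = n + 2 * n) (ofRatClass (ComplexPoints (X ⊗ X)) (2 * n) γ) := by
  have hXX : IsSmoothProjective (n + n) (X ⊗ X) := hX.tensor_holds hX
  have halgX : ∀ (p : ℕ), ∀ z ∈ (BettiUniverse.hodge hHD hX (2 * p)).hodgeClasses (p : ℤ), ofRatClass (ComplexPoints X) (2 * p) z ∈ algebraicClasses X p :=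
    fun p z hz ↦ hHC.2 p _ (isRationalClass_ofRatClass _) ((BettiUniverse.mem_hodgeClasses_hodge_iff_isOfHodgeType hHD hX p z).1 hz)
  -- the other Künneth pieces of `H^{2n}(X × X)` have algebraic Hodge classes
  have hpiece : ∀ (i j : ℕ) (hij : i + j = 2 * n), j ≠ n →
      ∀ u ∈ (BettiUniverse.kunnethSummand hHD hX hX (2 * n) ⟨(i, j), HasAntidiagonal.mem_antidiagonal.2 hij⟩).hodgeClasses n,
        ofRatClass (ComplexPoints (X ⊗ X)) (2 * n) (BettiUniverse.crossMap X X hij u) ∈ algebraicClasses (X ⊗ X) n := by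
    intro i j hij hjn u hu
    rcases Nat.even_or_odd i with ⟨a, ha⟩ | hi
    · obtain ⟨a, rfl⟩ : ∃ a', i = 2 * a' := ⟨a, by omega⟩
      obtain ⟨b, rfl⟩ : ∃ b, j = 2 * b := ⟨j / 2, by omega⟩
      have han : 2 * a ≠ n := by omega
      exact BettiUniverse.ofRatClass_crossMap_mem_algebraicClasses_of_hodgeClasses_eq_top_left hHD hX hX hij (heven a han)
        (fun z ↦ halgX a z (by rw [heven a han]; exact Submodule.mem_top)) (halgX b) hu
    · have hin : i ≠ n := by omega
      exact BettiUniverse.ofRatClass_crossMap_mem_algebraicClasses_of_finrank_eq_zero hX hX hij (Or.inl (hodd i hi hin)) u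
  -- `γ` is a Hodge class; its Künneth decomposition into Hodge classes
  have hγH : γ ∈ (BettiUniverse.hodge hHD hXX (2 * n)).hodgeClasses n := by
    refine (BettiUniverse.mem_hodgeClasses_hodge_iff_isOfHodgeType hHD hXX n γ).2 ?_
    exact isOfHodgeType_of_mem_algebraicClasses_of_isSmoothProjective hXX n hγ
  obtain ⟨t, ⟨ht, hsum⟩, -⟩ := BettiUniverse.exists_eq_kunnethMap_of_mem_hodgeClasses hHD hodgePQ_independent_of_hodgeModel_holds hX hX hXX (2 * n) n hγH
  set inn : ↥(antidiagonal (2 * n)) := ⟨(n, n), HasAntidiagonal.mem_antidiagonal.2 (two_mul n).symm⟩ with hinn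
  have hsplit : ofRatClass (ComplexPoints (X ⊗ X)) (2 * n) γ =
      ofRatClass (ComplexPoints (X ⊗ X)) (2 * n) (BettiUniverse.crossMap X X (mem_antidiagonal.1 inn.2) (t inn)) +
        ∑ ij ∈ univ.erase inn, ofRatClass (ComplexPoints (X ⊗ X)) (2 * n) (BettiUniverse.crossMap X X (mem_antidiagonal.1 ij.2) (t ij)) := by
    rw [hsum, map_sum, ← Finset.add_sum_erase univ _ (Finset.mem_univ inn)]
  have hothers : ∀ ij ∈ univ.erase inn, ij.1.2 ≠ n := by
    intro ij hij h
    have hne : ij ≠ inn := (Finset.mem_erase.1 hij).1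
    have hsum' : ij.1.1 + ij.1.2 = 2 * n := mem_antidiagonal.1 ij.2
    exact hne (Subtype.ext (Prod.ext (show ij.1.1 = n by omega) h))
  refine ⟨t inn, ht inn, ?_, ?_⟩
  · -- algebraicity
    have e : ofRatClass (ComplexPoints (X ⊗ X)) (2 * n) (BettiUniverse.crossMap X X (two_mul n).symm (t inn)) =
        ofRatClass (ComplexPoints (X ⊗ X)) (2 * n) γ - ∑ ij ∈ univ.erase inn, ofRatClass (ComplexPoints (X ⊗ X)) (2 * n) (BettiUniverse.crossMap X X (mem_antidiagonal.1 ij.2) (t ij)) := by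
      rw [hsplit, add_sub_cancel_right]
    rw [e]
    refine Submodule.sub_mem _ hγ (Submodule.sum_mem _ fun ij hij ↦ ?_)
    obtain ⟨⟨i, j⟩, hij'⟩ := ij
    exact hpiece i j (mem_antidiagonal.1 hij') (hothers _ hij) (t ⟨(i, j), hij'⟩) (ht ⟨(i, j), hij'⟩)
  · -- same action on `Hⁿ`
    rw [hsplit, map_add, map_sum, Finset.sum_eq_zero fun ij hij ↦ ?_, add_zero]
    obtain ⟨⟨i, j⟩, hij'⟩ := ij
    have hj : j ≠ n := hothers _ hij
    have hij2 : i + j = 2 * n := mem_antidiagonal.1 hij'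
    exact corrAction_eq_zero_of_mem_kunnethPiece_of_ne complexOrientationFamily hX hX (e := n) (i := j) (j := i) hij2
      (ofRatClass_crossMap_mem_kunnethPiece hij2 (t ⟨(i, j), hij'⟩)) (a := n) (b := n) rfl (show n + j ≠ 2 * n by omega)

end Middle

/-! ### §2 `HC(X × X)` when `End_HS(HⁿX)` is spanned by algebraic correspondences -/

/-- **`HC(X × X)` for `X` off-middle algebraic whose Hodge endomorphisms of `Hⁿ(X)` are accounted for by algebraic correspondences.**  Let `X` be smooth projective of dimension `n` with `HC(X)`,
`Hᵏ(X;ℚ) = 0` for odd `k ≠ n`, `Hdgᵖ(H^{2p}X) = H^{2p}(X;ℚ)` for `2p ≠ n`; let `γᵢ ∈ H^{2n}(X × X;ℚ)`, `i ∈ ι` finite, have algebraic complexifications and ℂ-LINEARLY INDEPENDENT actions `(γᵢ ⊗ 1)_*` on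
`Hⁿ(X;ℂ)`, and let `dim_ℚ End_HS(HⁿX) ≤ |ι|`.  Then `HC(X × X)`: the middle Künneth components `tᵢ` of the `γᵢ` (§1) are ℚ-linearly independent Hodge classes of `HⁿX ⊗ HⁿX` with algebraic cross products,
so they span `Hdgⁿ(HⁿX ⊗ HⁿX)` (of dimension `dim End_HS(HⁿX)`, Lemma 11.41); every other piece is handled by g29-#2/g29-#6. [cite: VoisinHodgeI2002, §11.3.3 Thm. 11.38–11.40, Lemma 11.41 and pp. 286–287]
[cite: Voisin2025, §3.2.1 (12)–(14), Prop. 3.8 and Cor. 3.9] [cite: Deligne2000, §1] -/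
theorem BettiUniverse.hodgeConjectureFor_tensor_self_of_offMiddle_algebraic_of_linearIndependent_corrAction {ι : Type} [Fintype ι] (hHD : exists_isReal_hodgeModel)
    (hX : IsSmoothProjective n X) (hXX : IsSmoothProjective d (X ⊗ X)) (hHC : HodgeConjectureFor n X) (hodd : ∀ k, Odd k → k ≠ n → Module.finrank ℚ (bettiCohomology X k) = 0)
    (heven : ∀ p, 2 * p ≠ n → (BettiUniverse.hodge hHD hX (2 * p)).hodgeClasses p = ⊤) (γ : ι → bettiCohomology (X ⊗ X) (2 * n))
    (hγ : ∀ i, ofRatClass (ComplexPoints (X ⊗ X)) (2 * n) (γ i) ∈ algebraicClasses (X ⊗ X) n)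
    (hind : LinearIndependent ℂ fun i ↦ corrAction complexOrientationFamily hX hX (rfl : n + 2 * n = n + 2 * n) (ofRatClass (ComplexPoints (X ⊗ X)) (2 * n) (γ i)))
    (hEnd : Module.finrank ℚ (HodgeStructure.Hom (BettiUniverse.hodge hHD hX n) (BettiUniverse.hodge hHD hX n)) ≤ Fintype.card ι) : HodgeConjectureFor d (X ⊗ X) := by
  classical
  haveI : HodgeTensorFacts.{0, 0} := hodgeTensorFacts_holds
  haveI := BettiUniverse.finite hX n
  have halgX : ∀ (p : ℕ), ∀ z ∈ (BettiUniverse.hodge hHD hX (2 * p)).hodgeClasses (p : ℤ), ofRatClass (ComplexPoints X) (2 * p) z ∈ algebraicClasses X p :=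
    fun p z hz ↦ hHC.2 p _ (isRationalClass_ofRatClass _) ((BettiUniverse.mem_hodgeClasses_hodge_iff_isOfHodgeType hHD hX p z).1 hz)
  -- the middle components of the `γ i`
  choose t ht halg hact using fun i ↦ BettiUniverse.exists_kunneth_middle_algebraic_corrAction_eq hHD hX hHC hodd heven (hγ i)
  have hli : LinearIndependent ℚ t := by
    rw [Fintype.linearIndependent_iff]
    intro g hg i
    have h0 := congrArg (fun s ↦ corrAction complexOrientationFamily hX hX (rfl : n + 2 * n = n + 2 * n)
      (ofRatClass (ComplexPoints (X ⊗ X)) (2 * n) (BettiUniverse.crossMap X X (two_mul n).symm s))) hg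
    simp only [map_sum, map_smul, ofRatClass_rat_smul', map_zero] at h0
    simp_rw [hact] at h0
    have h1 := (Fintype.linearIndependent_iff.1 hind) (fun i ↦ ((g i : ℚ) : ℂ)) h0 i
    exact_mod_cast h1
  refine BettiUniverse.hodgeConjectureFor_tensor_of_kunneth_pieces_pos_le hHD hX hX hXX hHC hHC fun c i j hij hi1 hi hj1 hj hc2 u hu ↦ ?_
  by_cases hmid : i = n ∧ j = n
  · -- the middle piece `Hⁿ ⊗ Hⁿ`
    obtain ⟨hin, hjn⟩ := hmid
    have hin' : n = i := hin.symm
    have hjn' : n = j := hjn.symm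
    subst hin'
    subst hjn'
    obtain rfl : n = c := by omega
    set T : Submodule ℚ (bettiCohomology X n ⊗[ℚ] bettiCohomology X n) := Submodule.span ℚ (Set.range t) with hT
    have ht' : ∀ k, t k ∈ ((BettiUniverse.hodge hHD hX n).tensor (BettiUniverse.hodge hHD hX n)).hodgeClasses (n : ℤ) := fun k ↦ ht k
    have hTle : T ≤ ((BettiUniverse.hodge hHD hX n).tensor (BettiUniverse.hodge hHD hX n)).hodgeClasses (n : ℤ) :=
      Submodule.span_le.2 (Set.range_subset_iff.2 ht')
    have hTrank : Module.finrank ℚ ↥T = Fintype.card ι := finrank_span_eq_card hli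
    have hHrank : Module.finrank ℚ ↥(((BettiUniverse.hodge hHD hX n).tensor (BettiUniverse.hodge hHD hX n)).hodgeClasses (n : ℤ)) =
        Module.finrank ℚ (HodgeStructure.Hom (BettiUniverse.hodge hHD hX n) (BettiUniverse.hodge hHD hX n)) :=
      BettiUniverse.finrank_hodgeClasses_tensor_hodge_eq_finrank_hom hHD hX hX n
    have hTeq : T = ((BettiUniverse.hodge hHD hX n).tensor (BettiUniverse.hodge hHD hX n)).hodgeClasses (n : ℤ) :=
      Submodule.eq_of_le_of_finrank_le hTle (by rw [hHrank, hTrank]; exact hEnd)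
    have hu' : u ∈ T := by
      rw [hTeq]
      exact hu
    obtain ⟨cf, rfl⟩ := (Submodule.mem_span_range_iff_exists_fun ℚ).1 hu'
    rw [map_sum, map_sum]
    refine Submodule.sum_mem _ fun k _ ↦ ?_
    rw [map_smul, ofRatClass_rat_smul']
    exact Submodule.smul_mem _ _ (halg k)
  -- the other pieces: zero or with a pure factor
  rcases Nat.even_or_odd i with ⟨a, ha⟩ | hio
  · obtain ⟨a, rfl⟩ : ∃ a', i = 2 * a' := ⟨a, by omega⟩
    obtain ⟨b, rfl⟩ : ∃ b, j = 2 * b := ⟨j / 2, by omega⟩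
    by_cases han : 2 * a = n
    · have hbn : 2 * b ≠ n := fun h ↦ hmid ⟨han, h⟩
      exact BettiUniverse.ofRatClass_crossMap_mem_algebraicClasses_of_hodgeClasses_eq_top_right hHD hX hX hij (heven b hbn) (halgX a)
        (fun z ↦ halgX b z (by rw [heven b hbn]; exact Submodule.mem_top)) hu
    · exact BettiUniverse.ofRatClass_crossMap_mem_algebraicClasses_of_hodgeClasses_eq_top_left hHD hX hX hij (heven a han)
        (fun z ↦ halgX a z (by rw [heven a han]; exact Submodule.mem_top)) (halgX b) hu
  · by_cases hin : i = n
    · have hjo : Odd j := by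
        rcases Nat.even_or_odd j with ⟨b, hb⟩ | hjo
        · exfalso
          obtain ⟨k, hk⟩ := hio
          omega
        · exact hjo
      have hjn : j ≠ n := fun h ↦ hmid ⟨hin, h⟩
      exact BettiUniverse.ofRatClass_crossMap_mem_algebraicClasses_of_finrank_eq_zero hX hX hij (Or.inr (hodd j hjo hjn)) u
    · exact BettiUniverse.ofRatClass_crossMap_mem_algebraicClasses_of_finrank_eq_zero hX hX hij (Or.inl (hodd i hio hin)) u

/-! ### §3 One endomorphism: the classes `[Δ]` and `[ᵗΓ_σ]` -/

/-- **`HC(X × X)` from the diagonal and the graph of an endomorphism.**  Let `X` be off-middle algebraic with `HC(X)` and `σ : X ⟶ X` an endomorphism such that `Id` and `σ^*` are linearly independent on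
`Hⁿ(X;ℂ)` (i.e. `Hⁿ(X) ≠ 0` and `σ^*|Hⁿ` is not a scalar) and `dim_ℚ End_HS(HⁿX) ≤ 2`.  Then `HC(X × X)`: apply §2 to `[Δ] = (𝟙,𝟙)_* 1` and `[ᵗΓ_σ] = (𝟙, σ)_* 1`, rational and algebraic classes of
`H^{2n}(X × X)` acting as `Id` and `σ^*`. [cite: VoisinHodgeI2002, §11.3.3 Lemma 11.41 and pp. 286–287] [cite: Fulton1998, §16.1 Prop. 16.1.2 and Def. 16.1.2] [cite: Kahn2020, §3.5.3 Example 3.47] [cite: Deligne2000, §1] -/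
theorem BettiUniverse.hodgeConjectureFor_tensor_self_of_offMiddle_algebraic_of_endomorphism (hHD : exists_isReal_hodgeModel) (hX : IsSmoothProjective n X) (hXX : IsSmoothProjective d (X ⊗ X))
    (hHC : HodgeConjectureFor n X) (hodd : ∀ k, Odd k → k ≠ n → Module.finrank ℚ (bettiCohomology X k) = 0) (heven : ∀ p, 2 * p ≠ n → (BettiUniverse.hodge hHD hX (2 * p)).hodgeClasses p = ⊤)
    (σ : X ⟶ X) (hind : LinearIndependent ℂ ![(LinearMap.id : complexBetti X n →ₗ[ℂ] complexBetti X n), (complexBetti.map σ n).hom])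
    (hEnd : Module.finrank ℚ (HodgeStructure.Hom (BettiUniverse.hodge hHD hX n) (BettiUniverse.hodge hHD hX n)) ≤ 2) : HodgeConjectureFor d (X ⊗ X) := by
  -- rational lifts of `[Δ]` and `[ᵗΓ_σ]`
  obtain ⟨δ, hδ⟩ := (isRationalClass_iff_mem_range_ofRatClass _).1 (isRationalClass_diagonalClass hX)
  set Γ : complexBetti (X ⊗ X) (2 * n) := complexGysin complexOrientationFamily hX (hX.tensor_holds hX) (lift (𝟙 X) σ) (show 0 + 2 * (n + n) = 2 * n + 2 * n by omega)
    (singularCohomology.one ℂ (ComplexPoints X)) with hΓ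
  obtain ⟨γ, hγ⟩ := (isRationalClass_iff_mem_range_ofRatClass _).1
    (isRationalClass_complexGysin_complexOrientationFamily hX (hX.tensor_holds hX) (lift (𝟙 X) σ) (show 0 + 2 * (n + n) = 2 * n + 2 * n by omega) (isRationalClass_one _) : IsRationalClass Γ)
  have hδalg : ofRatClass (ComplexPoints (X ⊗ X)) (2 * n) δ ∈ algebraicClasses (X ⊗ X) n := by
    rw [hδ]
    exact diagonalClass_mem_algebraicClasses hX
  have hγalg : ofRatClass (ComplexPoints (X ⊗ X)) (2 * n) γ ∈ algebraicClasses (X ⊗ X) n := by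
    rw [hγ]
    exact complexGysin_graph_one_mem_algebraicClasses complexOrientationFamily hasPoincareDuality_complexOrientationFamily hX (hX.tensor_holds hX) σ
  have hδact : corrAction complexOrientationFamily hX hX (rfl : n + 2 * n = n + 2 * n) (ofRatClass (ComplexPoints (X ⊗ X)) (2 * n) δ) = LinearMap.id := by
    rw [hδ]
    exact corrAction_diagonalClass_eq_id hX rfl
  have hγact : corrAction complexOrientationFamily hX hX (rfl : n + 2 * n = n + 2 * n) (ofRatClass (ComplexPoints (X ⊗ X)) (2 * n) γ) = (complexBetti.map σ n).hom := by
    rw [hγ]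
    exact corrAction_transposeGraph_one complexOrientationFamily hX hX σ rfl
  refine BettiUniverse.hodgeConjectureFor_tensor_self_of_offMiddle_algebraic_of_linearIndependent_corrAction (ι := Fin 2) hHD hX hXX hHC hodd heven ![δ, γ]
    (fun i ↦ by fin_cases i <;> simp [hδalg, hγalg]) ?_ (by simpa using hEnd)
  have e : (fun i : Fin 2 ↦ corrAction complexOrientationFamily hX hX (rfl : n + 2 * n = n + 2 * n) (ofRatClass (ComplexPoints (X ⊗ X)) (2 * n) (![δ, γ] i))) =
      ![(LinearMap.id : complexBetti X n →ₗ[ℂ] complexBetti X n), (complexBetti.map σ n).hom] := by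
    funext i
    fin_cases i
    · simp [hδact]
    · simp [hγact]
  rw [e]
  exact hind

end Literature.AlgebraicGeometry.HodgeTheory

/-! ### §4 Smooth hypersurfaces of odd dimension with an endomorphism -/

namespace Literature.AlgebraicGeometry.Motives.IsSmoothHypersurface

open Literature.AlgebraicGeometry.Motives
open Literature.AlgebraicGeometry.HodgeTheory

variable {m e : ℕ} {Y : SchemeOver ℂ}

/-- **`HC(Y × Y)` for a smooth hypersurface `Y` of ODD dimension `m` with an endomorphism `σ` such that `Id`, `σ^*` are independent on `Hᵐ(Y;ℂ)` and `dim_ℚ End_HS(HᵐY) ≤ 2`** (e.g. `End_HS(HᵐY) = ℚ[σ^*]`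
for an involution acting non-trivially): hypersurfaces are off-middle algebraic with `HC` in odd dimension (Cor. 1.24/1.25, g29-#7). [cite: VoisinHodgeII2003, §1.2.3 Cor. 1.24 and Cor. 1.25]
[cite: VoisinHodgeI2002, §11.3.3 Lemma 11.41 and pp. 286–287] [cite: Fulton1998, §16.1 Def. 16.1.2] -/
theorem hodgeConjectureFor_tensor_self_of_odd_of_endomorphism (hY : IsSmoothHypersurface m e Y) (hHD : exists_isReal_hodgeModel) (hm : Odd m) (σ : Y ⟶ Y)
    (hind : LinearIndependent ℂ ![(LinearMap.id : complexBetti Y m →ₗ[ℂ] complexBetti Y m), (complexBetti.map σ m).hom])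
    (hEnd : Module.finrank ℚ (HodgeStructure.Hom (BettiUniverse.hodge hHD hY.1 m) (BettiUniverse.hodge hHD hY.1 m)) ≤ 2) : HodgeConjectureFor (m + m) (Y ⊗ Y) :=
  BettiUniverse.hodgeConjectureFor_tensor_self_of_offMiddle_algebraic_of_endomorphism hHD hY.1 (hY.1.tensor_holds hY.1) (hY.hodgeConjectureFor_of_odd hHD hm)
    (fun _ hk hkm ↦ hY.finrank_bettiCohomology_eq_zero_of_odd hk hkm) (fun _ hp ↦ hY.hodgeClasses_hodge_eq_top_of_two_mul_ne hHD hY.1 hp) σ hind hEnd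

/-- The same with a FAMILY of algebraic correspondences (§2 read on hypersurfaces of odd dimension): `HC(Y × Y)` as soon as `dim End_HS(HᵐY)` algebraic classes `γᵢ ∈ H^{2m}(Y × Y;ℚ)` act independently on
`Hᵐ(Y;ℂ)`. [cite: VoisinHodgeII2003, §1.2.3 Cor. 1.24 and Cor. 1.25] [cite: VoisinHodgeI2002, §11.3.3 Lemma 11.41 and pp. 286–287] -/
theorem hodgeConjectureFor_tensor_self_of_odd_of_linearIndependent_corrAction {ι : Type} [Fintype ι] (hY : IsSmoothHypersurface m e Y) (hHD : exists_isReal_hodgeModel) (hm : Odd m)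
    (γ : ι → bettiCohomology (Y ⊗ Y) (2 * m)) (hγ : ∀ i, ofRatClass (ComplexPoints (Y ⊗ Y)) (2 * m) (γ i) ∈ algebraicClasses (Y ⊗ Y) m)
    (hind : LinearIndependent ℂ fun i ↦ corrAction complexOrientationFamily hY.1 hY.1 (rfl : m + 2 * m = m + 2 * m) (ofRatClass (ComplexPoints (Y ⊗ Y)) (2 * m) (γ i)))
    (hEnd : Module.finrank ℚ (HodgeStructure.Hom (BettiUniverse.hodge hHD hY.1 m) (BettiUniverse.hodge hHD hY.1 m)) ≤ Fintype.card ι) : HodgeConjectureFor (m + m) (Y ⊗ Y) :=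
  BettiUniverse.hodgeConjectureFor_tensor_self_of_offMiddle_algebraic_of_linearIndependent_corrAction hHD hY.1 (hY.1.tensor_holds hY.1) (hY.hodgeConjectureFor_of_odd hHD hm)
    (fun _ hk hkm ↦ hY.finrank_bettiCohomology_eq_zero_of_odd hk hkm) (fun _ hp ↦ hY.hodgeClasses_hodge_eq_top_of_two_mul_ne hHD hY.1 hp) γ hγ hind hEnd

end Literature.AlgebraicGeometry.Motives.IsSmoothHypersurface

end
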